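import Mathlib.LinearAlgebra.FreeModule.Finite.Matrix
import Mathlib.LinearAlgebra.FiniteDimensional.Lemmas
import Mathlib.LinearAlgebra.Dual.Lemmas
import HarnessLib

/-!
# The commutant of an `𝔰𝔩₂`-triple in isotypic position: it is `End(range P)`, of dimension `(rk P)²`, with
# scalar centre

Family `hodge`, layer `Literature/RepresentationTheory/GeneralLinear`; THEOREMS ONLY (no definition, no named fact;
D-0026).  Pure linear algebra over a field `K`, NO Hodge theory imported; written for the cell `pub-hodgecm2`
(COR-CM) lane MT-RANK-FOUR, where it is applied to the complexified Lie algebra of the Hodge group of a weight-one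
Hodge structure of Hodge-group rank `3` (`Motives/HodgeLieWeightOneRankThree`).

SETTING.  `W` a finite-dimensional `K`-space and `P, E, F ∈ End W`, `α ∈ Kˣ` with
`P² = P`, `P E = E`, `E P = 0`, `P F = 0`, `F P = F`, `E F = α P`, `F E = α (1 − P)`
— i.e. `W = W₁ ⊕ W₀` (`W₁ = range P`, `W₀ = ker P`), `E : W₀ ⥲ W₁`, `F : W₁ ⥲ W₀` mutually inverse up to `α`:
the standard representation of `𝔰𝔩₂ = ⟨2P − 1, E, F⟩` tensored with `W₁` (Fulton–Harris, Lecture 11: every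
finite-dimensional `𝔰𝔩₂ℂ`-module on which `H` has only the eigenvalues `±1` is a multiple of the standard one).
Let `C ⊆ End W` be the COMMUTANT of `{P, E, F}` (hypothesis `hC`, as a `K`-subspace).

* `mem_commutant_of_corner` — for every `Q` in the corner `P (End W) P` (`P Q = Q = Q P`), `Q + α⁻¹ F Q E ∈ C`;
  `eq_corner_add_of_mem_commutant` — every `T ∈ C` is of this form with `Q = T P`.
* **`finrank_commutant_eq_sq`** — `dim_K C = (dim_K range P)²`: `T ↦ T|_{range P}` is a linear isomorphism
  `C ≃ End(range P)` with inverse `f ↦ Q_f + α⁻¹ F Q_f E` (Schur: the commutant of `W₁ ⊗ std` is `End(W₁)`).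
* **`exists_eq_smul_one_of_mem_center_commutant`** — an element of `C` commuting with `C` is a scalar (`P ≠ 0`):
  its corner `T P` commutes with every `P u P`, hence is `c P` (test against rank-one `u`), and then `T = c · 1`.

## References

* [FultonHarris1991] W. Fulton, J. Harris, *Representation Theory*, GTM 129 (1991), Lecture 11, §11.1 (irreducible
  and isotypic `𝔰𝔩₂ℂ`-modules; eigenvalues of `H`).
* [Humphreys1972] J. E. Humphreys, *Introduction to Lie Algebras and Representation Theory*, GTM 9 (1972), §7.2,
  and §6.1 (Schur's lemma).
-/

namespace Literature.RepresentationTheory.GeneralLinear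

universe u v

variable {K : Type u} [Field K] {W : Type v} [AddCommGroup W] [Module K W] [FiniteDimensional K W]

namespace SL2Triple

/-! ## §1 Derived identities and the corner parametrisation of the commutant -/

omit [FiniteDimensional K W] in
/-- `E² = 0` and `F² = 0` for a triple in isotypic position. [cite: FultonHarris1991, Lecture 11 (§11.1)] -/
theorem mul_self_eq_zero {P E F : Module.End K W} (hPE : P * E = E) (hEP : E * P = 0) (hPF : P * F = 0)
    (hFP : F * P = F) : E * E = 0 ∧ F * F = 0 := by
  constructor
  · calc E * E = E * (P * E) := by rw [hPE]
      _ = (E * P) * E := (mul_assoc _ _ _).symm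
      _ = 0 := by rw [hEP, zero_mul]
  · calc F * F = (F * P) * F := by rw [hFP]
      _ = F * (P * F) := mul_assoc _ _ _
      _ = 0 := by rw [hPF, mul_zero]

omit [FiniteDimensional K W] in
/-- **Corner elements give commutant elements**: if `P Q = Q = Q P` then `T = Q + α⁻¹ F Q E` commutes with `P`, `E`
and `F` (`E Q = E P Q = 0`, `Q F = Q P F = 0`, `E F = α P`, `F E = α (1 − P)`).
[cite: FultonHarris1991, Lecture 11 (§11.1)] [cite: Humphreys1972, §6.1] -/
theorem mem_commutant_of_corner {P E F : Module.End K W} {α : K} (hα : α ≠ 0)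
    (hPE : P * E = E) (hEP : E * P = 0) (hPF : P * F = 0) (hFP : F * P = F) (hEF : E * F = α • P)
    {C : Submodule K (Module.End K W)}
    (hC : ∀ T, T ∈ C ↔ T * P = P * T ∧ T * E = E * T ∧ T * F = F * T)
    {Q : Module.End K W} (hPQ : P * Q = Q) (hQP : Q * P = Q) :
    Q + α⁻¹ • (F * Q * E) ∈ C := by
  obtain ⟨hEE, hFF⟩ := mul_self_eq_zero hPE hEP hPF hFP
  have hEQ : E * Q = 0 := by rw [← hPQ, ← mul_assoc, hEP, zero_mul]
  have hQF : Q * F = 0 := by rw [← hQP, mul_assoc, hPF, mul_zero]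
  rw [hC]
  refine ⟨?_, ?_, ?_⟩
  · -- `T P = Q = P T`
    rw [add_mul, smul_mul_assoc, mul_assoc (F * Q) E P, hEP, mul_zero, smul_zero, add_zero, hQP,
      mul_add, mul_smul_comm, ← mul_assoc, ← mul_assoc, hPF, zero_mul, zero_mul, smul_zero, add_zero, hPQ]
  · -- `T E = Q E = E T`
    rw [add_mul, smul_mul_assoc, mul_assoc (F * Q) E E, hEE, mul_zero, smul_zero, add_zero,
      mul_add, hEQ, zero_add, mul_smul_comm, ← mul_assoc, ← mul_assoc, hEF, smul_mul_assoc, smul_mul_assoc,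
      smul_smul, inv_mul_cancel₀ hα, one_smul, hPQ]
  · -- `T F = F Q = F T`
    rw [add_mul, hQF, zero_add, smul_mul_assoc, mul_assoc (F * Q) E F, hEF, mul_smul_comm, smul_smul,
      inv_mul_cancel₀ hα, one_smul, mul_assoc F Q P, hQP,
      mul_add, mul_smul_comm, ← mul_assoc, ← mul_assoc, hFF, zero_mul, zero_mul, smul_zero, add_zero]

omit [FiniteDimensional K W] in
/-- **Every `T` in the commutant is `T P + α⁻¹ F (T P) E`** (and `T P` lies in the corner): `F (T P) E = F T E =
F E T = α (1 − P) T`. [cite: FultonHarris1991, Lecture 11 (§11.1)] [cite: Humphreys1972, §6.1] -/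
theorem eq_corner_add_of_mem_commutant {P E F : Module.End K W} {α : K} (hα : α ≠ 0)
    (hPE : P * E = E) (hFE : F * E = α • (1 - P)) {C : Submodule K (Module.End K W)}
    (hC : ∀ T, T ∈ C ↔ T * P = P * T ∧ T * E = E * T ∧ T * F = F * T)
    {T : Module.End K W} (hT : T ∈ C) :
    T = T * P + α⁻¹ • (F * (T * P) * E) := by
  obtain ⟨hTP, hTE, -⟩ := (hC T).1 hT
  have h : F * (T * P) * E = α • ((1 - P) * T) := by
    rw [mul_assoc F (T * P) E, mul_assoc T P E, hPE, hTE, ← mul_assoc, hFE, smul_mul_assoc]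
  rw [h, smul_smul, inv_mul_cancel₀ hα, one_smul, sub_mul, one_mul, ← hTP]
  abel

/-! ## §2 The commutant is `End(range P)`: dimension `(rk P)²` -/

/-- **`dim_K C = (dim_K range P)²`** for the commutant `C` of a triple in isotypic position: restriction to
`W₁ = range P` is a `K`-linear isomorphism `C ≃ End_K(W₁)` (inverse `f ↦ Q_f + α⁻¹ F Q_f E`, `Q_f = ι ∘ f ∘ P`), and
`dim End_K(W₁) = (dim W₁)²` — Schur's lemma for the isotypic `𝔰𝔩₂`-module `W ≅ W₁ ⊗ std`.
[cite: FultonHarris1991, Lecture 11 (§11.1)] [cite: Humphreys1972, §6.1 and §7.2] -/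
theorem finrank_commutant_eq_sq {P E F : Module.End K W} {α : K} (hα : α ≠ 0) (hPP : P * P = P)
    (hPE : P * E = E) (hEP : E * P = 0) (hPF : P * F = 0) (hFP : F * P = F) (hEF : E * F = α • P)
    (hFE : F * E = α • (1 - P)) {C : Submodule K (Module.End K W)}
    (hC : ∀ T, T ∈ C ↔ T * P = P * T ∧ T * E = E * T ∧ T * F = F * T) :
    Module.finrank K C = Module.finrank K (LinearMap.range P) ^ 2 := by
  set R : Submodule K W := LinearMap.range P with hR
  -- `P` is the identity on `R`, `E` kills `R`
  have hPid : ∀ w ∈ R, P w = w := by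
    rintro _ ⟨u, rfl⟩
    rw [← Module.End.mul_apply, hPP]
  have hEk : ∀ w ∈ R, E w = 0 := by
    rintro _ ⟨u, rfl⟩
    rw [← Module.End.mul_apply, hEP, LinearMap.zero_apply]
  -- `T ∈ C` preserves `R`
  have hmaps : ∀ T : C, ∀ w ∈ R, (T : Module.End K W) w ∈ R := by
    rintro T _ ⟨u, rfl⟩
    obtain ⟨hTP, -, -⟩ := (hC T).1 T.2
    rw [← Module.End.mul_apply, hTP, Module.End.mul_apply]
    exact LinearMap.mem_range_self P _
  -- the lift `Q_f = ι ∘ f ∘ P` of `f ∈ End R` and its corner identities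
  let lift : (R →ₗ[K] R) → Module.End K W := fun f => R.subtype ∘ₗ f ∘ₗ P.rangeRestrict
  have hlift_apply : ∀ (f : R →ₗ[K] R) (u : W), lift f u = (f (P.rangeRestrict u) : W) := fun f u => rfl
  have hrr : ∀ u : W, P.rangeRestrict (P u) = P.rangeRestrict u := by
    intro u
    apply Subtype.ext
    change P (P u) = P u
    rw [← Module.End.mul_apply, hPP]
  have hrrR : ∀ w : R, P.rangeRestrict (w : W) = w := by
    intro w
    apply Subtype.ext
    change P (w : W) = w
    exact hPid w w.2
  have hPlift : ∀ f, P * lift f = lift f := by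
    intro f
    refine LinearMap.ext fun u => ?_
    rw [Module.End.mul_apply, hlift_apply, hPid _ (f _).2]
  have hliftP : ∀ f, lift f * P = lift f := by
    intro f
    refine LinearMap.ext fun u => ?_
    rw [Module.End.mul_apply, hlift_apply, hlift_apply, hrr]
  -- the linear equivalence `C ≃ End R`
  let Φ : C ≃ₗ[K] (R →ₗ[K] R) :=
    { toFun := fun T => (T : Module.End K W).restrict (hmaps T)
      map_add' := fun T T' => by
        refine LinearMap.ext fun w => Subtype.ext ?_
        simp only [LinearMap.coe_restrict_apply, Submodule.coe_add, LinearMap.add_apply]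
      map_smul' := fun c T => by
        refine LinearMap.ext fun w => Subtype.ext ?_
        simp only [LinearMap.coe_restrict_apply, LinearMap.smul_apply, RingHom.id_apply, SetLike.val_smul]
      invFun := fun f => ⟨lift f + α⁻¹ • (F * lift f * E),
        mem_commutant_of_corner hα hPE hEP hPF hFP hEF hC (hPlift f) (hliftP f)⟩
      left_inv := fun T => by
        apply Subtype.ext
        have hres : lift ((T : Module.End K W).restrict (hmaps T)) = (T : Module.End K W) * P := by
          refine LinearMap.ext fun u => ?_
          rw [hlift_apply, LinearMap.coe_restrict_apply]
          rfl
        change lift ((T : Module.End K W).restrict (hmaps T)) +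
            α⁻¹ • (F * lift ((T : Module.End K W).restrict (hmaps T)) * E) = (T : Module.End K W)
        rw [hres]
        exact (eq_corner_add_of_mem_commutant hα hPE hFE hC T.2).symm
      right_inv := fun f => by
        refine LinearMap.ext fun w => Subtype.ext ?_
        rw [LinearMap.coe_restrict_apply]
        change (lift f + α⁻¹ • (F * lift f * E)) (w : W) = (f w : W)
        rw [LinearMap.add_apply, LinearMap.smul_apply, Module.End.mul_apply, Module.End.mul_apply, hEk w w.2,
          map_zero, map_zero, smul_zero, add_zero, hlift_apply, hrrR] }
  rw [Φ.finrank_eq, Module.finrank_linearMap, pow_two]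

/-! ## §3 The centre of the commutant is scalar -/

omit [FiniteDimensional K W] in
/-- **An element of the commutant commuting with the whole commutant is a scalar** (`P ≠ 0`).  Write `A = T P`
(the corner of `T`); for every `u ∈ End W` the corner element `P u P` gives `P u P + α⁻¹ F (P u P) E ∈ C`, and
commuting `T` with it yields `A u P = P u A`; testing on rank-one `u = φ ⊗ x` gives `A = c P`, hence
`T = A + α⁻¹ F A E = c P + c (1 − P) = c · 1` (the centre of `End(W₁) ≅ C` is `K`).
[cite: Humphreys1972, §6.1] [cite: FultonHarris1991, Lecture 11 (§11.1)] -/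
theorem exists_eq_smul_one_of_mem_center_commutant {P E F : Module.End K W} {α : K} (hα : α ≠ 0)
    (hPP : P * P = P) (hPE : P * E = E) (hEP : E * P = 0) (hPF : P * F = 0) (hFP : F * P = F)
    (hEF : E * F = α • P) (hFE : F * E = α • (1 - P)) (hP0 : P ≠ 0) {C : Submodule K (Module.End K W)}
    (hC : ∀ T, T ∈ C ↔ T * P = P * T ∧ T * E = E * T ∧ T * F = F * T)
    {T : Module.End K W} (hT : T ∈ C) (hcomm : ∀ T' ∈ C, T * T' = T' * T) :
    ∃ c : K, T = c • 1 := by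
  have hTP : T * P = P * T := ((hC T).1 hT).1
  have hAP : T * P * P = T * P := by rw [mul_assoc, hPP]
  have hPA : P * (T * P) = T * P := by rw [← mul_assoc, ← hTP, mul_assoc, hPP]
  -- `A = T P` commutes with every corner element `P u P`
  have hcorner : ∀ u : Module.End K W, T * P * u * P = P * u * (T * P) := by
    intro u
    have hPQ : P * (P * u * P) = P * u * P := by rw [← mul_assoc, ← mul_assoc, hPP]
    have hQP : P * u * P * P = P * u * P := by rw [mul_assoc, hPP]
    have hmem := mem_commutant_of_corner hα hPE hEP hPF hFP hEF hC hPQ hQP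
    have h := hcomm _ hmem
    -- multiply `T (Q + α⁻¹ F Q E) = (Q + α⁻¹ F Q E) T` by `P` on both sides
    have h' := congrArg (fun Z : Module.End K W => P * Z * P) h
    simp only [mul_add, add_mul, mul_smul_comm, smul_mul_assoc] at h'
    have h1 : P * (T * (P * u * P)) * P = T * P * u * P := by
      rw [← mul_assoc P T (P * u * P), ← hTP, mul_assoc (T * P) (P * u * P) P, hQP,
        ← mul_assoc (T * P) (P * u) P, ← mul_assoc (T * P) P u, hAP]
    have h2 : P * (T * (F * (P * u * P) * E)) * P = 0 := by
      rw [← mul_assoc P T (F * (P * u * P) * E), ← hTP, mul_assoc T P (F * (P * u * P) * E),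
        ← mul_assoc P (F * (P * u * P)) E, ← mul_assoc P F (P * u * P), hPF, zero_mul, zero_mul, mul_zero,
        zero_mul]
    have h3 : P * (P * u * P * T) * P = P * u * (T * P) := by
      rw [← mul_assoc P (P * u * P) T, hPQ, mul_assoc (P * u * P) T P, mul_assoc (P * u) P (T * P), hPA]
    have h4 : P * (F * (P * u * P) * E * T) * P = 0 := by
      rw [← mul_assoc P (F * (P * u * P) * E) T, ← mul_assoc P (F * (P * u * P)) E, ← mul_assoc P F (P * u * P),
        hPF, zero_mul, zero_mul, zero_mul, zero_mul]
    rw [h1, h2, h3, h4, smul_zero, add_zero, add_zero] at h'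
    exact h'
  -- test on rank-one operators: `A = c • P`
  obtain ⟨w₀, hw₀⟩ : ∃ w₀ : W, P w₀ ≠ 0 := by
    by_contra h
    push Not at h
    exact hP0 (LinearMap.ext fun w => by rw [h w, LinearMap.zero_apply])
  obtain ⟨φ₀, hφ₀⟩ : ∃ φ₀ : Module.Dual K W, φ₀ (P w₀) ≠ 0 := by
    by_contra h
    push Not at h
    exact hw₀ ((Module.forall_dual_apply_eq_zero_iff K (P w₀)).1 h)
  set c : K := (φ₀ (P w₀))⁻¹ * φ₀ ((T * P) w₀) with hc
  have hAc : T * P = c • P := by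
    refine LinearMap.ext fun x => ?_
    have h := LinearMap.congr_fun (hcorner (φ₀.smulRight x)) w₀
    simp only [Module.End.mul_apply, LinearMap.smulRight_apply, map_smul] at h
    -- `h : φ₀ (P w₀) • (T (P x)) = φ₀ (T (P w₀)) • P x`
    rw [LinearMap.smul_apply, hc, mul_smul, Module.End.mul_apply, Module.End.mul_apply, ← h, smul_smul,
      inv_mul_cancel₀ hφ₀, one_smul]
  -- conclude `T = c • 1`
  refine ⟨c, ?_⟩
  have hcoef : α⁻¹ * c * α = c := by field_simp
  rw [eq_corner_add_of_mem_commutant hα hPE hFE hC hT, hAc, mul_smul_comm, smul_mul_assoc, hFP, hFE,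
    smul_smul, smul_smul, hcoef, ← smul_add, add_sub_cancel]

end SL2Triple

end Literature.RepresentationTheory.GeneralLinear
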